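import Summits.QuantumFields.BalabanUV.Beta.D1BFx.ShellRoadEnd
import Summits.QuantumFields.BalabanUV.Beta.D1BFx.RoadEndPinned

/-!
# `BalabanUV.Beta.D1BFx.ShellRoadEndMean` — road «BF-x» for binder row D1: THE MEAN-GRADING ROAD ENDS (`RoadEnd` §4, `RoadEndPinned`) WITH THE
# MIXED-SECOND-DIFFERENCE ROWS h2∕d2 IN SHELL-ℓ¹ CURRENCY

HONEST DEPENDENCY (page 1, mandatory): continuum YM on T⁴ ⇐ BetaPertH ∧ nine spine estimates (0/9 proved); BetaPertH ⇐ (D1) ∧ (D4) ∧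
CAP+tail; G-an2-4 gates asym, D1 and NE2/3/4.  HONEST FRAMING (cell contract, verbatim): «discharging `BetaPertH` makes Bałaban's UV
stability UNCONDITIONAL — a real constructive-QFT result; it is NOT the continuum limit and NOT the Clay problem.»  THIS MODULE DISCHARGES
NOTHING of the wall: [folklore] sequence algebra copied VERBATIM from `RoadEnd.tableSide_drift` ∕ `RoadEnd.d1Drift_of_meanRoad_table` (owner d1-p2,
p207094) and `RoadEndPinned.d1Drift_JsBalAn1Ctr_of_meanRoad_table_pinned` (p220307) with an3's pointwise scalar wall replaced BY NAME by leaf-07-g4's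
`ShellGradedRoad.oneLoopDrift_of_scalarShellBounds_avg` — exactly as leaf-07-g4's `ShellRoadEnd` did for the strong grading (C3).  Every binder is a
HYPOTHESIS with free constants; no `def`, no `Prop` mirror, no cited fact, 0 sorry; 0 wall binders instantiated; NOT D1, NOT `BetaPertH`, NOT continuum,
NOT Clay.

ABSOLUTE RULE (cell charter, verbatim): «No internally-minted statement may enter as a cited fact. Every hypothesis is either kernel-proved in
this package or a verbatim quotation of a PUBLISHED theorem with page reference. The manuscript(s) under audit are NOT citable for their own
disputed steps — they are the thing under adjudication; programme-internal (2001/route/tribunal) claims are never citable.»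

WHY: the pointwise rows h2∕d2 (same-leg mixed second differences, `D₂/n⁴` ∕ `A₂e^{−(δ/n)‖v‖}/‖v‖⁴`) are presumably UNSATISFIABLE by the road's frozen
profile `gfrz` (edge log: leaf-07-g3 journal l.10890, beta-num-g33 l.11249, leaf-03-g5 RESULT «EDGE-LOG-ROW» kit j101443∕j101444∕j101445) and are not
in [Balaban1984PropagatorsI, Prop. 1.2]'s printed pointwise list; the shell rows `h2s` ∕ `d2s` are of the measured size.  `ShellRoadEnd` gave the
strong-grading END in shell currency; this file gives the MEAN-grading ENDs, so that the owner's `RoadEndBFxRecutMean` has a shell twin too.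
CONTENT.  `tableSide_drift_shell`, `d1Drift_of_meanRoad_table_shell` (any `Js`; all-scales bound + Cesàro-null B1 + mean target + rows
h0∕h1∕h2s∕d0∕d1∕d2s), `d1Drift_JsBalAn1Ctr_of_meanRoad_table_pinned_shell` (the road's literal at the pin; the all-scales binder is gan24-p1's theorem).
Unit `b2b-balaban-beta-d1-formalise-leaf-03` (gen 5), D1 formalisation swarm; `LEAVES-BFx.md` sub-row «C2-SHELL».
-/

open Finset Filter Topology
open scoped BigOperators
open Literature.Probability.LatticeModels (annulus)
open Literature.MathematicalPhysics.QuantumFieldTheory.Balaban1983to89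
open Literature.MathematicalPhysics.QuantumFieldTheory.Balaban1983to89.Beta
open RemainderConstAllScales (AllScalesSeq)
open OneStepResolventKernel (JetData)
open OneStepKernelFamily (TbalOf D1Drift)
open MarginalTelescoping (composedCoeff IdentityForm)
open WindowIdentification (fullSum)
open DyadicShell (Pt supNorm)
open SquareTable (stK)
open GhostTable (gFree)
open BubbleTransfer (unitVec)
open ScalewiseVectorSeam (splitOf)
open Summit.QuantumFields.BalabanUV.Beta.MixedJetTablesPlug (JsBalAn1Ctr)
open Summit.QuantumFields.BalabanUV.Beta.GAN24.StencilSlotOfE3 (one_le_of_two_le)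
open Summit.QuantumFields.BalabanUV.Beta.GAN24.WSlotT2TablesAn1 (allScalesSeq_secondMoment_JsBalAn1Ctr_pinned)
open Summit.QuantumFields.BalabanUV.Beta.D1BFx.ShellGradedRoad (oneLoopDrift_of_scalarShellBounds_avg)
open Summit.QuantumFields.BalabanUV.Beta.D1BFx.RoadEnd (d1Drift_of_meanRoad)

namespace Summit.QuantumFields.BalabanUV.Beta.D1BFx.ShellRoadEndMean

variable {Lc : ℕ} [NeZero Lc] {κB : Type*}

omit [NeZero Lc] in
/-- [folklore] **THE BASE-POINT-AVERAGED TABLE SIDE DRIFTS BY ITSELF, SHELL CURRENCY** — `RoadEnd.tableSide_drift` with the rows h2∕d2 SHELL-SUMMED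
(`h2s`: `Σ_{‖v‖∞=r+1}|D_{μν}(Gf n b − gFree)(v)| ≤ D₂/n` for `r + 1 ≤ n`; `d2s`: `Σ_{‖v‖∞=r+1}|D_{μν}(Gf n b)(v)| ≤ A₂e^{−(δ/n)(r+1)}/(r+1)` for `r ≥ n`),
through `ShellGradedRoad.oneLoopDrift_of_scalarShellBounds_avg` at the TAUTOLOGICAL split `β⁰_j := F (Lc^(j+1)) − F (Lc^j)`. -/
theorem tableSide_drift_shell {μ ν : Fin 4} (hμν : μ ≠ ν) {N : ℝ} (hN : N ≠ 0) (hL : 2 ≤ Lc)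
    {Bset : ℕ → Finset κB} {wt : ℕ → κB → ℝ} {Gf : ℕ → κB → Pt → ℝ} {D A : ℕ → ℝ}
    (hD : ∀ j, 0 ≤ D j) (hA : ∀ j, 0 ≤ A j) {δ : ℝ} (hδ : 0 < δ)
    (hwt0 : ∀ n : ℕ, 2 ≤ n → ∀ b ∈ Bset n, 0 ≤ wt n b) (hwt1 : ∀ n : ℕ, 2 ≤ n → ∑ b ∈ Bset n, wt n b = 1)
    (h0 : ∀ n : ℕ, 2 ≤ n → ∀ b ∈ Bset n, ∀ v, |Gf n b v - gFree v| ≤ D 0 / (n : ℝ) ^ 2)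
    (h1 : ∀ n : ℕ, 2 ≤ n → ∀ b ∈ Bset n, ∀ v (ρ : Fin 4),
      |(Gf n b (v + unitVec ρ) - gFree (v + unitVec ρ)) - (Gf n b v - gFree v)| ≤ D 1 / (n : ℝ) ^ 3)
    (h2s : ∀ n : ℕ, 2 ≤ n → ∀ b ∈ Bset n, ∀ r : ℕ, r + 1 ≤ n →
      ∑ v ∈ annulus 4 r (r + 1), |(Gf n b (v + unitVec ν + unitVec μ) - gFree (v + unitVec ν + unitVec μ)) -
          (Gf n b (v + unitVec ν) - gFree (v + unitVec ν)) - (Gf n b (v + unitVec μ) - gFree (v + unitVec μ)) +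
          (Gf n b v - gFree v)| ≤ D 2 / (n : ℝ))
    (d0 : ∀ n : ℕ, 2 ≤ n → ∀ b ∈ Bset n, ∀ v : Pt, v ≠ 0 → |Gf n b v| ≤ A 0 * Real.exp (-(δ / n) * supNorm v) / (supNorm v : ℝ) ^ 2)
    (d1 : ∀ n : ℕ, 2 ≤ n → ∀ b ∈ Bset n, ∀ v : Pt, v ≠ 0 → ∀ ρ : Fin 4,
      |Gf n b (v + unitVec ρ) - Gf n b v| ≤ A 1 * Real.exp (-(δ / n) * supNorm v) / (supNorm v : ℝ) ^ 3)
    (d2s : ∀ n : ℕ, 2 ≤ n → ∀ b ∈ Bset n, ∀ r : ℕ, n ≤ r →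
      ∑ v ∈ annulus 4 r (r + 1), |Gf n b (v + unitVec ν + unitVec μ) - Gf n b (v + unitVec ν) - Gf n b (v + unitVec μ) + Gf n b v| ≤
        A 2 * Real.exp (-(δ / n) * ((r : ℝ) + 1)) / ((r : ℝ) + 1)) :
    ∃ A' : ℝ, ∀ m : ℕ,
      |(∑ b ∈ Bset (Lc ^ m), wt (Lc ^ m) b * fullSum (stK μ ν N (Gf (Lc ^ m) b)))
          - (∑ b ∈ Bset (Lc ^ 0), wt (Lc ^ 0) b * fullSum (stK μ ν N (Gf (Lc ^ 0) b)))
          - B12Normalization.stepBal N Lc * m| ≤ A' := by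
  set F : ℕ → ℝ := fun n => ∑ b ∈ Bset n, wt n b * fullSum (stK μ ν N (Gf n b)) with hF
  set incr : ℕ → ℝ := fun j => F (Lc ^ (j + 1)) - F (Lc ^ j) with hincr
  have hsum : ∀ m : ℕ, ∑ j ∈ range m, incr j = F (Lc ^ m) - F (Lc ^ 0) := fun m =>
    Finset.sum_range_sub (fun j => F (Lc ^ j)) m
  have hid : IdentityForm (fun j _ => incr j) (splitOf incr).β0 := fun _ _ _ => rfl
  have hcomp : ∀ m, composedCoeff (fun j _ => incr j) m = ∑ j ∈ range m, incr j := fun _ => rfl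
  have hU : ∀ m : ℕ, 1 ≤ m → |composedCoeff (fun j _ => incr j) m - F (Lc ^ m)| ≤ |F (Lc ^ 0)| := by
    intro m _
    rw [hcomp, hsum, show F (Lc ^ m) - F (Lc ^ 0) - F (Lc ^ m) = -F (Lc ^ 0) by ring, abs_neg]
  have hc : (1 : ℝ) ≤ 1 := le_rfl
  have hM : ∀ L : ℕ, 2 ≤ L → 1 ≤ (fun n : ℕ => n) L ∧ (L : ℝ) ≤ 1 * ((fun n : ℕ => n) L : ℕ) := fun L hL2 =>
    ⟨le_trans (by norm_num) hL2, by simp⟩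
  have hML : ∀ L : ℕ, 2 ≤ L → (fun n : ℕ => n) L ≤ L := fun _ _ => le_rfl
  have hdrift := oneLoopDrift_of_scalarShellBounds_avg (splitOf incr) hμν hN hL (μC := fun j _ => incr j) (M := fun n : ℕ => n) hD hA hδ
    hwt0 hwt1 hc hM hML h0 h1 (fun n hn b hb r hr => h2s n hn b hb r hr) d0 d1 (fun n hn b hb r hr => d2s n hn b hb r hr) hU hid
  obtain ⟨A', hA'⟩ : ∃ A' : ℝ, Drift.OneLoopDrift (B12Normalization.stepBal N Lc) A' incr := ⟨_, hdrift⟩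
  refine ⟨A', fun m => ?_⟩
  rw [← hsum]
  exact hA' m

/-- [folklore] **THE MEAN ROAD END IN THE TABLE CURRENCY, SHELL CURRENCY FOR THE MIXED DIFFERENCES** — `RoadEnd.d1Drift_of_meanRoad_table` with h2∕d2
↦ h2s∕d2s: for ANY jet data `Js`, an all-scales bound (`0 ≤ θ < 1`), a CESÀRO-NULL telescoping defect against a one-shot coefficient `c (Lc^m)`, the MEAN
target `(c (Lc^m) − F (Lc^m))/m → 0` over a leg family `Gf`, and the rows h0∕h1∕h2s∕d0∕d1∕d2s ⟹ `D1Drift Lc Js N μ ν`. -/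
theorem d1Drift_of_meanRoad_table_shell (Js : ℕ → JetData 3 Lc) {μ ν : Fin 4} (hμν : μ ≠ ν) {N : ℝ} (hN : N ≠ 0) (hL : 2 ≤ Lc) {κ θ : ℝ}
    (hall : AllScalesSeq (fun j => B12Beta.secondMoment (TbalOf Lc Js j) μ ν) κ θ) (hθ0 : 0 ≤ θ) (hθ1 : θ < 1)
    (c : ℕ → ℝ) {Bset : ℕ → Finset κB} {wt : ℕ → κB → ℝ} {Gf : ℕ → κB → Pt → ℝ} {D A : ℕ → ℝ}
    (hD : ∀ j, 0 ≤ D j) (hA : ∀ j, 0 ≤ A j) {δ : ℝ} (hδ : 0 < δ)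
    (hwt0 : ∀ n : ℕ, 2 ≤ n → ∀ b ∈ Bset n, 0 ≤ wt n b) (hwt1 : ∀ n : ℕ, 2 ≤ n → ∑ b ∈ Bset n, wt n b = 1)
    (h0 : ∀ n : ℕ, 2 ≤ n → ∀ b ∈ Bset n, ∀ v, |Gf n b v - gFree v| ≤ D 0 / (n : ℝ) ^ 2)
    (h1 : ∀ n : ℕ, 2 ≤ n → ∀ b ∈ Bset n, ∀ v (ρ : Fin 4),
      |(Gf n b (v + unitVec ρ) - gFree (v + unitVec ρ)) - (Gf n b v - gFree v)| ≤ D 1 / (n : ℝ) ^ 3)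
    (h2s : ∀ n : ℕ, 2 ≤ n → ∀ b ∈ Bset n, ∀ r : ℕ, r + 1 ≤ n →
      ∑ v ∈ annulus 4 r (r + 1), |(Gf n b (v + unitVec ν + unitVec μ) - gFree (v + unitVec ν + unitVec μ)) -
          (Gf n b (v + unitVec ν) - gFree (v + unitVec ν)) - (Gf n b (v + unitVec μ) - gFree (v + unitVec μ)) +
          (Gf n b v - gFree v)| ≤ D 2 / (n : ℝ))
    (d0 : ∀ n : ℕ, 2 ≤ n → ∀ b ∈ Bset n, ∀ v : Pt, v ≠ 0 → |Gf n b v| ≤ A 0 * Real.exp (-(δ / n) * supNorm v) / (supNorm v : ℝ) ^ 2)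
    (d1 : ∀ n : ℕ, 2 ≤ n → ∀ b ∈ Bset n, ∀ v : Pt, v ≠ 0 → ∀ ρ : Fin 4,
      |Gf n b (v + unitVec ρ) - Gf n b v| ≤ A 1 * Real.exp (-(δ / n) * supNorm v) / (supNorm v : ℝ) ^ 3)
    (d2s : ∀ n : ℕ, 2 ≤ n → ∀ b ∈ Bset n, ∀ r : ℕ, n ≤ r →
      ∑ v ∈ annulus 4 r (r + 1), |Gf n b (v + unitVec ν + unitVec μ) - Gf n b (v + unitVec ν) - Gf n b (v + unitVec μ) + Gf n b v| ≤
        A 2 * Real.exp (-(δ / n) * ((r : ℝ) + 1)) / ((r : ℝ) + 1))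
    (hB1 : Tendsto (fun m : ℕ => ((∑ j ∈ range m, B12Beta.secondMoment (TbalOf Lc Js j) μ ν) - c (Lc ^ m)) / (m : ℝ)) atTop (𝓝 0))
    (hT : Tendsto (fun m : ℕ => (c (Lc ^ m) - ∑ b ∈ Bset (Lc ^ m), wt (Lc ^ m) b * fullSum (stK μ ν N (Gf (Lc ^ m) b))) / (m : ℝ))
      atTop (𝓝 0)) :
    D1Drift Lc Js N μ ν := by
  set F : ℕ → ℝ := fun n => ∑ b ∈ Bset n, wt n b * fullSum (stK μ ν N (Gf n b)) with hF
  set s : ℝ := B12Normalization.stepBal N Lc with hs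
  obtain ⟨A', hA'⟩ := tableSide_drift_shell hμν hN hL hD hA hδ hwt0 hwt1 h0 h1 h2s d0 d1 d2s
  have hF0 : Tendsto (fun m : ℕ => (F (Lc ^ m) - F (Lc ^ 0) - s * m) / (m : ℝ)) atTop (𝓝 0) := by
    refine squeeze_zero_norm' ?_ (tendsto_const_div_atTop_nhds_zero_nat A')
    filter_upwards [eventually_ge_atTop 1] with m hm
    have hmpos : (0 : ℝ) < m := by exact_mod_cast hm
    rw [Real.norm_eq_abs, abs_div, abs_of_pos hmpos]
    exact div_le_div_of_nonneg_right (hA' m) hmpos.le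
  have hF1 : Tendsto (fun m : ℕ => F (Lc ^ 0) / (m : ℝ)) atTop (𝓝 0) := tendsto_const_div_atTop_nhds_zero_nat _
  have hFm : Tendsto (fun m : ℕ => F (Lc ^ m) / (m : ℝ)) atTop (𝓝 s) := by
    have h := (hF0.add hF1).add (tendsto_const_nhds (x := s))
    rw [zero_add, zero_add] at h
    refine h.congr' ?_
    filter_upwards [eventually_ge_atTop 1] with m hm
    have hmne : (m : ℝ) ≠ 0 := by exact_mod_cast (Nat.one_le_iff_ne_zero.mp hm)
    field_simp
    ring
  have hcm : Tendsto (fun m : ℕ => c (Lc ^ m) / (m : ℝ)) atTop (𝓝 s) := by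
    have h := hT.add hFm
    rw [zero_add] at h
    refine h.congr' (Eventually.of_forall fun m => ?_)
    simp only [hF, sub_div, sub_add_cancel]
  exact d1Drift_of_meanRoad Js hall hθ0 hθ1 N c hB1 hcm

/-- [folklore] **THE MEAN ROAD END FOR THE ROAD'S LITERAL AT THE PIN, TABLE CURRENCY, SHELL ROWS** — `RoadEndPinned.d1Drift_JsBalAn1Ctr_of_meanRoad_table_pinned`
with h2∕d2 ↦ h2s∕d2s (the all-scales binder is gan24-p1's `allScalesSeq_secondMoment_JsBalAn1Ctr_pinned`, a theorem). -/
theorem d1Drift_JsBalAn1Ctr_of_meanRoad_table_pinned_shell (hLc : 2 ≤ Lc) (cE cVH cΛ cB : ℝ) (Tc : Fin 4 → Fin 4 → Fin 4 → Fin 4 → ℝ)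
    {μ ν : Fin 4} (hμν : μ ≠ ν) {N : ℝ} (hN : N ≠ 0) (c : ℕ → ℝ) {Bset : ℕ → Finset κB} {wt : ℕ → κB → ℝ} {Gf : ℕ → κB → Pt → ℝ}
    {D A : ℕ → ℝ} (hD : ∀ j, 0 ≤ D j) (hA : ∀ j, 0 ≤ A j) {δ : ℝ} (hδ : 0 < δ)
    (hwt0 : ∀ n : ℕ, 2 ≤ n → ∀ b ∈ Bset n, 0 ≤ wt n b) (hwt1 : ∀ n : ℕ, 2 ≤ n → ∑ b ∈ Bset n, wt n b = 1)
    (h0 : ∀ n : ℕ, 2 ≤ n → ∀ b ∈ Bset n, ∀ v, |Gf n b v - gFree v| ≤ D 0 / (n : ℝ) ^ 2)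
    (h1 : ∀ n : ℕ, 2 ≤ n → ∀ b ∈ Bset n, ∀ v (ρ : Fin 4),
      |(Gf n b (v + unitVec ρ) - gFree (v + unitVec ρ)) - (Gf n b v - gFree v)| ≤ D 1 / (n : ℝ) ^ 3)
    (h2s : ∀ n : ℕ, 2 ≤ n → ∀ b ∈ Bset n, ∀ r : ℕ, r + 1 ≤ n →
      ∑ v ∈ annulus 4 r (r + 1), |(Gf n b (v + unitVec ν + unitVec μ) - gFree (v + unitVec ν + unitVec μ)) -
          (Gf n b (v + unitVec ν) - gFree (v + unitVec ν)) - (Gf n b (v + unitVec μ) - gFree (v + unitVec μ)) +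
          (Gf n b v - gFree v)| ≤ D 2 / (n : ℝ))
    (d0 : ∀ n : ℕ, 2 ≤ n → ∀ b ∈ Bset n, ∀ v : Pt, v ≠ 0 → |Gf n b v| ≤ A 0 * Real.exp (-(δ / n) * supNorm v) / (supNorm v : ℝ) ^ 2)
    (d1 : ∀ n : ℕ, 2 ≤ n → ∀ b ∈ Bset n, ∀ v : Pt, v ≠ 0 → ∀ ρ : Fin 4,
      |Gf n b (v + unitVec ρ) - Gf n b v| ≤ A 1 * Real.exp (-(δ / n) * supNorm v) / (supNorm v : ℝ) ^ 3)
    (d2s : ∀ n : ℕ, 2 ≤ n → ∀ b ∈ Bset n, ∀ r : ℕ, n ≤ r →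
      ∑ v ∈ annulus 4 r (r + 1), |Gf n b (v + unitVec ν + unitVec μ) - Gf n b (v + unitVec ν) - Gf n b (v + unitVec μ) + Gf n b v| ≤
        A 2 * Real.exp (-(δ / n) * ((r : ℝ) + 1)) / ((r : ℝ) + 1))
    (hB1 : Tendsto (fun m : ℕ => ((∑ j ∈ range m,
        B12Beta.secondMoment (TbalOf Lc (JsBalAn1Ctr (one_le_of_two_le hLc) cE cVH cΛ ((Lc : ℝ) ^ (2 * (3 + 1))) cB Tc) j) μ ν) - c (Lc ^ m)) / (m : ℝ))
        atTop (𝓝 0))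
    (hT : Tendsto (fun m : ℕ => (c (Lc ^ m) - ∑ b ∈ Bset (Lc ^ m), wt (Lc ^ m) b * fullSum (stK μ ν N (Gf (Lc ^ m) b))) / (m : ℝ))
      atTop (𝓝 0)) :
    D1Drift Lc (JsBalAn1Ctr (one_le_of_two_le hLc) cE cVH cΛ ((Lc : ℝ) ^ (2 * (3 + 1))) cB Tc) N μ ν := by
  obtain ⟨κ, θ, hθ0, hθ1, hall⟩ := allScalesSeq_secondMoment_JsBalAn1Ctr_pinned hLc cE cVH cΛ cB Tc μ ν
  exact d1Drift_of_meanRoad_table_shell _ hμν hN hLc hall hθ0 hθ1 c hD hA hδ hwt0 hwt1 h0 h1 h2s d0 d1 d2s hB1 hT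

end Summit.QuantumFields.BalabanUV.Beta.D1BFx.ShellRoadEndMean
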